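import Literature.Probability.LatticeModels.TorusFourierProofs
import HarnessLib

/-!
# Block coordinates on the discrete torus and characters at aliased momenta

Topic `Probability/LatticeModels`; companion of `TorusFourier.lean` / `TorusFourierProofs.lean`
(characters `torusChar` of `(ℤ/Lℤ)^d`). The coarse-graining ("block-spin") map of the torus
`(ℤ/bNℤ)^d → (ℤ/Nℤ)^d`, `x ↦ ⌊x/b⌋` (canonical representatives), its section `(X, a) ↦ bX + a`
(`a ∈ [0,b)^d` the intra-block offset) — together a bijection
`(ℤ/Nℤ)^d × [0,b)^d ≃ (ℤ/bNℤ)^d` (`blockEquiv`) — and the elementary character identities behind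
Poisson summation over the block lattice `b(ℤ/bNℤ)^d ≅ (ℤ/Nℤ)^d`: with the ALIASED fine momenta
`q_r = Q + N r`, `r ∈ [0,b)^d`, above a coarse momentum `Q`,
* `torusChar_blockMomentum_blockBase` — `χ_{q_r}(bX) = χ_Q(X)`;
* `sum_torusChar_blockMomentum` — `Σ_r χ_{q_r}(v) = χ_{q_0}(v) · b^d · [b ∣ vᵢ ∀ i]`
  (geometric sums of `b`-th roots of unity, `sum_exp_two_pi_mul_div`);
* `forall_dvd_blockOffset_sub_iff` — `b ∣ (a - w)ᵢ ∀ i ↔ a = w mod b`.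
The aliasing identity for block-summed kernels built on these is `BlockKernelFourier.lean`.
Friedli–Velenik (2017) §10.4 (Fourier analysis on the discrete torus); folklore.

## References

* [FriedliVelenik2017] S. Friedli, Y. Velenik, *Statistical Mechanics of Lattice Systems*,
  Cambridge University Press (2017), §10.4 (discrete Fourier transform on the torus).
-/

noncomputable section

open Finset Complex
open scoped ComplexConjugate Real BigOperators

namespace Literature.Probability.LatticeModels

variable {d : ℕ}

/-! ### Block coordinates on `(ℤ/bNℤ)^d` -/

section Defs

variable (b N : ℕ) [NeZero b] [NeZero N]

/-- The fine site with block index `X ∈ (ℤ/Nℤ)^d` and intra-block offset `a ∈ [0,b)^d`: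
`(bX + a)ᵢ = b·Xᵢ + aᵢ` (on canonical representatives). [folklore] -/
def blockPoint (X : TorusSite d N) (a : Fin d → Fin b) : TorusSite d (b * N) :=
  fun i => ((b * (X i).val + (a i : ℕ) : ℕ) : ZMod (b * N))

/-- The base point `bX` of the block with index `X`. [folklore] -/
def blockBase (X : TorusSite d N) : TorusSite d (b * N) :=
  fun i => ((b * (X i).val : ℕ) : ZMod (b * N))

/-- The intra-block offset `a ∈ [0,b)^d` as a fine site. [folklore] -/
def blockOffset (a : Fin d → Fin b) : TorusSite d (b * N) :=
  fun i => (((a i : ℕ)) : ZMod (b * N))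

/-- The block index `⌊x/b⌋ ∈ (ℤ/Nℤ)^d` of a fine site (canonical representatives). [folklore] -/
def torusBlockOf (x : TorusSite d (b * N)) : TorusSite d N :=
  fun i => (((x i).val / b : ℕ) : ZMod N)

/-- The intra-block offset `x mod b ∈ [0,b)^d` of a fine site. [folklore] -/
def torusBoxOf (x : TorusSite d (b * N)) : Fin d → Fin b :=
  fun i => ⟨(x i).val % b, Nat.mod_lt _ (Nat.pos_of_ne_zero (NeZero.ne b))⟩

/-- The aliased fine momenta above a coarse momentum `Q ∈ (ℤ/Nℤ)^d`: `(q_r)ᵢ = Qᵢ + N rᵢ`,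
`r ∈ [0,b)^d`. [folklore] -/
def blockMomentum (Q : TorusSite d N) (r : Fin d → Fin b) : TorusSite d (b * N) :=
  fun i => (((Q i).val + N * (r i : ℕ) : ℕ) : ZMod (b * N))

/-- The block form factor `F_b(q) = Σ_{a ∈ [0,b)^d} χ_q(a)`. [folklore] -/
def blockFormFactor (q : TorusSite d (b * N)) : ℂ :=
  ∑ a : Fin d → Fin b, torusChar q (blockOffset b N a)

end Defs

section Coordinates

variable (b N : ℕ) [NeZero b] [NeZero N]

omit [NeZero b] in
/-- `b·Xᵢ + aᵢ < bN`. [folklore] -/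
theorem blockPoint_lt (X : TorusSite d N) (a : Fin d → Fin b) (i : Fin d) :
    b * (X i).val + (a i : ℕ) < b * N := by
  have hX : (X i).val < N := ZMod.val_lt (X i)
  have ha : (a i : ℕ) < b := (a i).isLt
  calc b * (X i).val + (a i : ℕ) < b * (X i).val + b := by omega
    _ = b * ((X i).val + 1) := by ring
    _ ≤ b * N := Nat.mul_le_mul_left b hX

omit [NeZero b] in
/-- The canonical representative of `bX + a` is `b·Xᵢ + aᵢ`. [folklore] -/
theorem val_blockPoint (X : TorusSite d N) (a : Fin d → Fin b) (i : Fin d) :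
    (blockPoint b N X a i).val = b * (X i).val + (a i : ℕ) := by
  rw [blockPoint, ZMod.val_natCast, Nat.mod_eq_of_lt (blockPoint_lt b N X a i)]

omit [NeZero b] [NeZero N] in
/-- `bX + a = bX + a` (base point plus offset). [folklore] -/
theorem blockPoint_eq_add (X : TorusSite d N) (a : Fin d → Fin b) :
    blockPoint b N X a = blockBase b N X + blockOffset b N a := by
  funext i
  simp [blockPoint, blockBase, blockOffset, Nat.cast_add]

/-- `⌊(bX + a)/b⌋ = X`. [folklore] -/
theorem torusBlockOf_blockPoint (X : TorusSite d N) (a : Fin d → Fin b) :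
    torusBlockOf b N (blockPoint b N X a) = X := by
  funext i
  have hb : 0 < b := Nat.pos_of_ne_zero (NeZero.ne b)
  rw [torusBlockOf, val_blockPoint, Nat.mul_add_div hb, Nat.div_eq_of_lt (a i).isLt, add_zero,
    ZMod.natCast_zmod_val]

/-- `(bX + a) mod b = a`. [folklore] -/
theorem torusBoxOf_blockPoint (X : TorusSite d N) (a : Fin d → Fin b) :
    torusBoxOf b N (blockPoint b N X a) = a := by
  funext i
  apply Fin.ext
  simp only [torusBoxOf, val_blockPoint]
  rw [Nat.mul_add_mod, Nat.mod_eq_of_lt (a i).isLt]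

/-- `b⌊x/b⌋ + (x mod b) = x`. [folklore] -/
theorem blockPoint_torusBlockOf_torusBoxOf (x : TorusSite d (b * N)) :
    blockPoint b N (torusBlockOf b N x) (torusBoxOf b N x) = x := by
  funext i
  apply ZMod.val_injective
  have hb : 0 < b := Nat.pos_of_ne_zero (NeZero.ne b)
  have hx : (x i).val < b * N := ZMod.val_lt (x i)
  have hdiv : (x i).val / b < N := Nat.div_lt_of_lt_mul hx
  have hval : (((((x i).val / b : ℕ)) : ZMod N)).val = (x i).val / b := by
    rw [ZMod.val_natCast, Nat.mod_eq_of_lt hdiv]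
  rw [val_blockPoint]
  simp only [torusBlockOf, torusBoxOf, hval]
  exact Nat.div_add_mod (x i).val b

/-- **Block coordinates**: `(ℤ/Nℤ)^d × [0,b)^d ≃ (ℤ/bNℤ)^d`, `(X, a) ↦ bX + a`. [folklore] -/
def blockEquiv : TorusSite d N × (Fin d → Fin b) ≃ TorusSite d (b * N) where
  toFun p := blockPoint b N p.1 p.2
  invFun x := (torusBlockOf b N x, torusBoxOf b N x)
  left_inv p := by
    rcases p with ⟨X, a⟩
    simp only [torusBlockOf_blockPoint, torusBoxOf_blockPoint]
  right_inv x := blockPoint_torusBlockOf_torusBoxOf b N x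

/-- **Summation in block coordinates**: `Σ_x g(x) = Σ_X Σ_a g(bX + a)`. [folklore] -/
theorem sum_eq_sum_blockPoint {M : Type*} [AddCommMonoid M] (g : TorusSite d (b * N) → M) :
    ∑ x : TorusSite d (b * N), g x =
      ∑ X : TorusSite d N, ∑ a : Fin d → Fin b, g (blockPoint b N X a) := by
  rw [← Fintype.sum_prod_type']
  exact (Fintype.sum_equiv (blockEquiv b N) _ _ fun p => rfl).symm

/-- Membership in the block `B_X` through representatives: `(∀ i, xᵢ / b = Xᵢ) ↔ ⌊x/b⌋ = X`.
[folklore] -/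
theorem forall_val_div_eq_iff (x : TorusSite d (b * N)) (X : TorusSite d N) :
    (∀ i, (x i).val / b = (X i).val) ↔ torusBlockOf b N x = X := by
  have hb : 0 < b := Nat.pos_of_ne_zero (NeZero.ne b)
  constructor
  · intro h
    funext i
    rw [torusBlockOf, h i, ZMod.natCast_zmod_val]
  · rintro rfl i
    have hx : (x i).val < b * N := ZMod.val_lt (x i)
    have hdiv : (x i).val / b < N := Nat.div_lt_of_lt_mul hx
    rw [torusBlockOf, ZMod.val_natCast, Nat.mod_eq_of_lt hdiv]

/-- In block coordinates the membership test reads `(∀ i, (bX+a)ᵢ / b = Yᵢ) ↔ X = Y`. [folklore] -/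
theorem forall_val_blockPoint_div_eq_iff (X Y : TorusSite d N) (a : Fin d → Fin b) :
    (∀ i, (blockPoint b N X a i).val / b = (Y i).val) ↔ X = Y := by
  rw [forall_val_div_eq_iff, torusBlockOf_blockPoint]

omit [NeZero b] in
/-- `bX` is additive: `b(X + Y) = bX + bY` in `(ℤ/bNℤ)^d`. [folklore] -/
theorem blockBase_add (X Y : TorusSite d N) :
    blockBase b N (X + Y) = blockBase b N X + blockBase b N Y := by
  funext i
  simp only [blockBase, Pi.add_apply]
  rw [← Nat.cast_add, ← mul_add, ZMod.natCast_eq_natCast_iff', ZMod.val_add, Nat.mul_mod_mul_left,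
    Nat.mul_mod_mul_left, Nat.mod_mod]

omit [NeZero b] [NeZero N] in
/-- `b·0 = 0`. [folklore] -/
@[simp] theorem blockBase_zero : blockBase b N (0 : TorusSite d N) = 0 := by
  funext i
  simp [blockBase]

omit [NeZero b] in
/-- `b(-X) = -bX`. [folklore] -/
theorem blockBase_neg (X : TorusSite d N) : blockBase b N (-X) = -blockBase b N X := by
  have h := blockBase_add b N (-X) X
  rw [neg_add_cancel, blockBase_zero] at h
  exact (neg_eq_of_add_eq_zero_left h.symm).symm

omit [NeZero b] in
/-- `b(X - Y) = bX - bY`. [folklore] -/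
theorem blockBase_sub (X Y : TorusSite d N) :
    blockBase b N (X - Y) = blockBase b N X - blockBase b N Y := by
  rw [sub_eq_add_neg, blockBase_add, blockBase_neg, ← sub_eq_add_neg]

/-- `b⌊x/b⌋ + (x mod b) = x`, offset form: `x = b⌊x/b⌋ + offset(x mod b)`. [folklore] -/
theorem blockBase_torusBlockOf_add_blockOffset_torusBoxOf (x : TorusSite d (b * N)) :
    blockBase b N (torusBlockOf b N x) + blockOffset b N (torusBoxOf b N x) = x := by
  rw [← blockPoint_eq_add, blockPoint_torusBlockOf_torusBoxOf]

end Coordinates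

/-! ### Characters at the aliased momenta -/

section Characters

variable (b N : ℕ) [NeZero b] [NeZero N]

/-- The standard character on a natural-number representative: `e(k) = exp(2πi k/L)`. [folklore] -/
theorem stdAddChar_natCast (L : ℕ) [NeZero L] (k : ℕ) :
    (ZMod.stdAddChar ((k : ℕ) : ZMod L) : ℂ) = Complex.exp (2 * π * I * (k : ℂ) / (L : ℂ)) := by
  have h := ZMod.stdAddChar_coe (N := L) (k : ℤ)
  push_cast at h
  exact h

/-- `e(k z) = exp(2πi k z.val/L)` for a natural number `k`. [folklore] -/
theorem stdAddChar_natCast_mul (L : ℕ) [NeZero L] (k : ℕ) (z : ZMod L) :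
    (ZMod.stdAddChar (((k : ℕ) : ZMod L) * z) : ℂ) =
      Complex.exp (2 * π * I * (((k * z.val : ℕ)) : ℂ) / (L : ℂ)) := by
  have h : ((k : ℕ) : ZMod L) * z = (((k * z.val : ℕ)) : ZMod L) := by
    rw [Nat.cast_mul, ZMod.natCast_zmod_val]
  rw [h, stdAddChar_natCast]

/-- **Geometric sum of `b`-th roots of unity**: `Σ_{s<b} exp(2πi s m/b) = b` if `b ∣ m`, else `0`.
[folklore] -/
theorem sum_exp_two_pi_mul_div (m : ℕ) :
    ∑ s : Fin b, Complex.exp (2 * π * I * ((((s : ℕ) * m : ℕ)) : ℂ) / (b : ℂ)) =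
      if b ∣ m then (b : ℂ) else 0 := by
  have hb0 : (b : ℂ) ≠ 0 := Nat.cast_ne_zero.2 (NeZero.ne b)
  set ω : ℂ := Complex.exp (2 * π * I * (m : ℂ) / (b : ℂ)) with hω
  have hterm : ∀ s : ℕ, Complex.exp (2 * π * I * ((((s : ℕ) * m : ℕ)) : ℂ) / (b : ℂ)) = ω ^ s := by
    intro s
    rw [hω, ← Complex.exp_nat_mul]
    congr 1
    push_cast
    ring
  simp_rw [hterm]
  rw [Fin.sum_univ_eq_sum_range (fun s => ω ^ s) b]
  have hωb : ω ^ b = 1 := by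
    rw [hω, ← Complex.exp_nat_mul]
    have : (b : ℂ) * (2 * π * I * (m : ℂ) / (b : ℂ)) = (m : ℕ) * (2 * π * I) := by
      field_simp
    rw [this, Complex.exp_nat_mul_two_pi_mul_I]
  split_ifs with hdvd
  · obtain ⟨k, rfl⟩ := hdvd
    have hω1 : ω = 1 := by
      rw [hω]
      have : 2 * π * I * ((b * k : ℕ) : ℂ) / (b : ℂ) = (k : ℕ) * (2 * π * I) := by
        push_cast
        field_simp
      rw [this, Complex.exp_nat_mul_two_pi_mul_I]
    simp [hω1]
  · have hω1 : ω ≠ 1 := by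
      intro h1
      rw [hω, Complex.exp_eq_one_iff] at h1
      obtain ⟨n, hn⟩ := h1
      have h2 : (m : ℂ) = (n : ℂ) * (b : ℂ) := by
        have h2πI : (2 * π * I : ℂ) ≠ 0 := by
          have : (π : ℂ) ≠ 0 := Complex.ofReal_ne_zero.2 Real.pi_ne_zero
          simp [this, Complex.I_ne_zero]
        field_simp at hn
        linear_combination hn
      have h3 : (m : ℤ) = n * (b : ℤ) := by
        have : ((m : ℤ) : ℂ) = ((n * (b : ℤ) : ℤ) : ℂ) := by push_cast; exact h2
        exact_mod_cast this
      exact hdvd (Int.natCast_dvd_natCast.1 ⟨n, by rw [h3, mul_comm]⟩)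
    rw [geom_sum_eq hω1, hωb, sub_self, zero_div]

/-- **The aliased characters restricted to the block lattice are the coarse characters**:
`χ_{q_r}(bX) = χ_Q(X)` (`q_r = Q + Nr`; `exp(2πi rᵢXᵢ) = 1`). [folklore] -/
theorem torusChar_blockMomentum_blockBase (Q X : TorusSite d N) (r : Fin d → Fin b) :
    torusChar (blockMomentum b N Q r) (blockBase b N X) = torusChar Q X := by
  have hb0 : (b : ℂ) ≠ 0 := Nat.cast_ne_zero.2 (NeZero.ne b)
  have hN0 : (N : ℂ) ≠ 0 := Nat.cast_ne_zero.2 (NeZero.ne N)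
  unfold torusChar
  refine Finset.prod_congr rfl fun i _ => ?_
  simp only [blockMomentum, blockBase]
  rw [← Nat.cast_mul, stdAddChar_natCast, stdAddChar_mul_eq_exp]
  have key : 2 * π * I * (((((Q i).val + N * (r i : ℕ)) * (b * (X i).val) : ℕ)) : ℂ) / ((b * N : ℕ) : ℂ) =
      2 * π * I * (((((Q i).val * (X i).val : ℕ)) : ℝ) : ℂ) / (N : ℂ) +
        ((((r i : ℕ) * (X i).val : ℕ)) : ℂ) * (2 * π * I) := by
    push_cast
    field_simp
  rw [key, Complex.exp_add, Complex.exp_nat_mul_two_pi_mul_I, mul_one]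

/-- The aliased character on a fine site factorises coordinatewise into the `r = 0` character and
`b`-th roots of unity: `χ_{q_r}(v) = χ_{q_0}(v) · Πᵢ exp(2πi rᵢ vᵢ/b)`. [folklore] -/
theorem torusChar_blockMomentum_eq (Q : TorusSite d N) (r : Fin d → Fin b) (v : TorusSite d (b * N)) :
    torusChar (blockMomentum b N Q r) v =
      torusChar (blockMomentum b N Q (fun _ => 0)) v *
        ∏ i, Complex.exp (2 * π * I * (((((r i : ℕ)) * (v i).val : ℕ)) : ℂ) / (b : ℂ)) := by
  have hb0 : (b : ℂ) ≠ 0 := Nat.cast_ne_zero.2 (NeZero.ne b)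
  have hN0 : (N : ℂ) ≠ 0 := Nat.cast_ne_zero.2 (NeZero.ne N)
  unfold torusChar
  rw [← Finset.prod_mul_distrib]
  refine Finset.prod_congr rfl fun i _ => ?_
  simp only [blockMomentum, Fin.val_zero, mul_zero, add_zero]
  rw [stdAddChar_natCast_mul, stdAddChar_natCast_mul, ← Complex.exp_add]
  congr 1
  push_cast
  field_simp

/-- **Orthogonality over the aliases**: `Σ_r χ_{q_r}(v) = χ_{q_0}(v) · b^d · [b ∣ vᵢ for all i]`.
[folklore] -/
theorem sum_torusChar_blockMomentum (Q : TorusSite d N) (v : TorusSite d (b * N)) :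
    ∑ r : Fin d → Fin b, torusChar (blockMomentum b N Q r) v =
      torusChar (blockMomentum b N Q (fun _ => 0)) v *
        (if ∀ i, b ∣ (v i).val then (b : ℂ) ^ d else 0) := by
  rw [Finset.sum_congr rfl fun r _ => torusChar_blockMomentum_eq b N Q r v, ← Finset.mul_sum]
  congr 1
  rw [← Fintype.prod_sum (fun i (s : Fin b) =>
    Complex.exp (2 * π * I * (((((s : ℕ)) * (v i).val : ℕ)) : ℂ) / (b : ℂ)))]
  simp_rw [sum_exp_two_pi_mul_div]
  rw [Fintype.prod_ite_zero, Finset.prod_const, Finset.card_univ, Fintype.card_fin]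
  split_ifs <;> rfl

/-- **Divisibility of the offset difference singles out the box representative**:
`(∀ i, b ∣ (a - w)ᵢ) ↔ a = w mod b`. [folklore] -/
theorem forall_dvd_blockOffset_sub_iff (a : Fin d → Fin b) (w : TorusSite d (b * N)) :
    (∀ i, b ∣ ((blockOffset b N a - w) i).val) ↔ a = torusBoxOf b N w := by
  have hcast : ∀ z : ZMod (b * N), b ∣ z.val ↔ (ZMod.castHom (dvd_mul_right b N) (ZMod b) z) = 0 := by
    intro z
    conv_rhs => rw [← ZMod.natCast_zmod_val z, map_natCast, ZMod.natCast_eq_zero_iff]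
  have hcoord : ∀ i, (b ∣ ((blockOffset b N a - w) i).val ↔ a i = torusBoxOf b N w i) := by
    intro i
    rw [hcast, Pi.sub_apply, map_sub, sub_eq_zero, blockOffset]
    conv_lhs => rw [← ZMod.natCast_zmod_val (w i), map_natCast, map_natCast,
      ZMod.natCast_eq_natCast_iff', Nat.mod_eq_of_lt (a i).isLt]
    simp only [torusBoxOf]
    constructor
    · intro h
      exact Fin.ext h
    · intro h
      exact congrArg Fin.val h
  constructor
  · intro h
    funext i
    exact (hcoord i).1 (h i)
  · intro h i
    exact (hcoord i).2 (congrFun h i)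

end Characters

end Literature.Probability.LatticeModels
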